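import Summits.BirchSwinnertonDyer.BirchSwinnertonDyer.Theorems.QuadraticBranchSignedControlPlusEtaR0Rows01
import Summits.BirchSwinnertonDyer.BirchSwinnertonDyer.Theorems.QuadraticBranchSignedControlPlusEtaR0KuriharaRecords05
import HarnessLib

/-!
# Route `QuadraticBranchSignedControl` (rung K8, cell `bsd-potss`), crux `PlusEtaLowerInclusion`
# (stmt-BirchSwinnertonDyer-19601): THE RANK-0 TOWER-ONTO ROWS, COMPOSED — part 04
# (continuation of `…PlusEtaR0Rows01.lean`: same §1 generic compositions, further per-row corollaries;
# seat `bsd-potss-k8eta-c1`, gen 2; `--supports` crux 19601)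

Rows in this file: `414150cd1`@5, `141512r1`@7.

Per certified rank-`0` tower-onto row `W` (census kit j255146; unit Kurihara numbers kit kit j261654, records
`PlusEtaR0Kurihara.etaR0_kur_v<label>_<p>` in `…PlusEtaR0KuriharaRecordsNN.lean`): the named facts (`hPT`,
`hmod`, GZK, Kobayashi 2.2_η / 4.1_η, Kitajima–Otsuki 1.3_η, Kim 2026 Thm. 1.8 (6), Cremona's Manin
computation or the Manin binder) + the DISPLAYED row data ⟹ for EVERY globally minimal `V` with
`C • W^{(p*)} = V`, good at `p`, `a_p(V) = 0`, `ρ_{V,p^m}` onto for all `m`: (E⁺_η)(V,p) ∧ (C1⁺_η)(V,p),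
via `PlusEtaR0Rows.etaPair_of_rankZero_of_missingLowerBoundAt` (part 01, ctrl g4's converse road p463421)
— resp. `etaPair_of_rankZero_of_shaAn_eq` for the Ш_an-unit Tamagawa-defect rows (exact analytic Sha displayed).
HONEST LABEL: CONDITIONAL per-row instances of the registered stubs' slots (`stub_etaLower_r0_lowerBSD` /
`stub_etaLower_r0_ofLowerBSD`); the class-wide stubs stay OPEN; crux 19601 is NOT closed; nothing is booked;
`BSD(W,p)` is claimed for no row; no `sorry`, no new definition, axioms standard. The full framing, the row
table and the residue are in part 01's module docstring.

References: [Kobayashi2003] §4 + Thm. 4.1 (p. 8), Thm. 2.2 (p. 5); [KitajimaOtsuki2018] Thm. 1.3;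
[Kim2022StructureSelmer] Thm. 1.9 (6); [Miller2011LMS] Def. 1.1; [Cremona1997] Table 1.
-/

set_option autoImplicit false
-- sibling precedent (`…PlusEtaLowerInclusionRung39675m1.lean`): the directory name repeats the summit name
set_option linter.dupNamespace false

noncomputable section

open scoped Classical

open CongruenceSubgroup WeierstrassCurve Literature.NumberTheory.EllipticCurves
open Literature.NumberTheory.EllipticCurves.ModularForms
open Literature.NumberTheory.EllipticCurves.Rank1Residual
open Literature.NumberTheory.EllipticCurves.Rank1Residual.Typed
open Literature.NumberTheory.EllipticCurves.Rank1Residual.X11RankOneCertificates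
open Literature.NumberTheory.GaloisRepresentations
open Literature.NumberTheory.GaloisCohomology
open Summit.BirchSwinnertonDyer.Rank1Residual
open Summit.BirchSwinnertonDyer.Rank1Residual.Additive
open Summit.BirchSwinnertonDyer.Rank1Residual.X4
open Summit.BirchSwinnertonDyer.Rank1Residual.X11b
open Summit.BirchSwinnertonDyer.Rank1Residual.Supersingular
open Summit.BirchSwinnertonDyer.BirchSwinnertonDyer.Rank1Residual.IntModel
open Summit.BirchSwinnertonDyer.BirchSwinnertonDyer.Rank1Residual.X11RankOne

namespace Summit.BirchSwinnertonDyer.BirchSwinnertonDyer.Theorems.PlusEtaR0Rows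

/-! ## §2 (continued) The certified rows (one unit Kurihara number each) -/

/-- **(E⁺_η) ∧ (C1⁺_η) at `p = 5` for EVERY tower-onto good twist of `W = 414150cd1`** (Cremona's minimal model `[1, 1, 1, -1875818638, 31269686593031]`,
`N = 414150 = 5²·16566`, additive `e = 2` at `5`; minimal `5*`-twist `V = 16566f1`: good supersingular, `a_5(V) = 0`, `ρ_{V,5^∞}` onto,
`r_an(V) = 0` — census kit j255146; `r_an(W) = 0`, `#Ш(W)_an = 25`, `∏ c_ℓ(W) = 8`, `#W(ℚ)_tors = 2`): the named facts + Kim 2026 Thm. 1.8 (6)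
+ the DISPLAYED row data (`r_an(W) = 0`; the optimal datum; the Manin binder `hc : 5 ∤ c_D` (`N > 300000`); the unit Kurihara number `δ̃_{143441} ≢ 0 (mod 5)` at the cyclic
pair level `n = 191·751 ∈ 𝒩₁(W,5)`, kit j261654) give L₀(W,5) by the record `PlusEtaR0Kurihara.etaR0_kur_v414150cd1_5`
(minimality, `Δ ≠ 0`, surjectivity of `ρ̄_{W,5}` and the level IN THE KERNEL there), whence the pair's (E⁺_η) and (C1⁺_η) by §1.
Statement shape = the registered rung `stub_etaLower_rung_39675m1_inputs` generalised to this row. CONDITIONAL; a per-row instance; nothing booked; `BSD(W,5)` not claimed.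
[cite: Kobayashi2003, §4 Even main conjecture and Thm. 4.1 (p. 8)] [cite: Kim2022StructureSelmer, Thm. 1.9 (6) (PDF p. 8)] [cite: Cremona1997, Table 1 (label 414150cd1)] -/
theorem etaPair_r0_v414150cd1_5
    (hPT : poitouTate_selmerStructure_duality_real ℚ) (hmod : hasEntireLFunction_rat)
    (hGZK : rank_eq_analyticRank_of_analyticRank_le_one)
    (h22 : Kobayashi2003.thm22_etaSignedSelmerDual_finite_torsion)
    (h41 : Kobayashi2003.thm41_plusEtaCharIdeal_dvd)
    (hKO : KitajimaOtsuki2018.mainThm13_etaSignedSelmerDual_noFiniteSubmodule)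
    (hKim : Kim2026.rankZero_le_padicValNat_sha_of_kuriharaNumber_ne_zero)
    (W : WeierstrassCurve ℚ) (hW : W = ⟨1, 1, 1, -1875818638, 31269686593031⟩)
    (hr : W.analyticRank = 0) (D : ModularParametrizationData W 414150)
    (hopt : ∀ z ∈ D.L.lattice, ∃ w ∈ periodLattice D.f, z = D.c * w)
    (hc : ¬ ((5 : ℕ) : ℤ) ∣ D.maninConstant)
    (hδ : ∃ ψ : (ℓ : ℕ) → (ZMod ℓ)ˣ →* Multiplicative (ZMod (5 ^ 1)),
      (∀ ℓ ∈ (191 * 751 : ℕ).primeFactors, Function.Surjective (ψ ℓ)) ∧ kuriharaNumber D.f (5 ^ 1) (191 * 751) ψ ≠ 0) :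
    ∀ (V : WeierstrassCurve ℚ) [V.IsElliptic] [V.IsGloballyMinimal] [Fact (5 : ℕ).Prime],
      (∃ C : VariableChange ℚ, C • W.quadraticTwist 5 = V) →
      V.HasGoodReductionAtPrime 5 → V.frobeniusTrace 5 = 0 →
      (∀ m : ℕ, V.HasSurjectiveModNGaloisRep (5 ^ m : ℕ)) →
        QuadraticBranchPlusEtaLowerInclusionAt V 5 ∧ QuadraticBranchPlusEtaMainConjectureAt V 5 := by
  have hlow : MissingLowerBoundAt W 5 :=
    PlusEtaR0Kurihara.etaR0_kur_v414150cd1_5 hKim hGZK hmod W hW hr D hopt hc hδ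
  subst hW
  haveI := PlusEtaR0Kurihara.isElliptic_v414150cd1
  haveI := PlusEtaR0Kurihara.isGloballyMinimal_v414150cd1
  intro V _ _ _ hC hgood hap hsurj
  obtain ⟨C, hCV⟩ := hC
  have hD : ((-1 : ℚ) ^ ((5 : ℕ) / 2) * ((5 : ℕ) : ℚ)) = 5 := by norm_num
  exact etaPair_of_rankZero_of_missingLowerBoundAt hPT hmod hGZK h22 h41 hKO _ 5 (by norm_num) hr hlow V C
    (by rw [hD]; exact hCV) hgood hap hsurj

/-- **(E⁺_η) ∧ (C1⁺_η) at `p = 7` for EVERY tower-onto good twist of `W = 141512r1`** (Cremona's minimal model `[0, 1, 0, -2128576, -2202603488]`,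
`N = 141512 = 7²·2888`, additive `e = 2` at `7`; minimal `7*`-twist `V = 2888e1`: good supersingular, `a_7(V) = 0`, `ρ_{V,7^∞}` onto,
`r_an(V) = 1` — census kit j255146; `r_an(W) = 0`, `#Ш(W)_an = 49`, `∏ c_ℓ(W) = 2`, `#W(ℚ)_tors = 1`): the named facts + Kim 2026 Thm. 1.8 (6)
+ the DISPLAYED row data (`r_an(W) = 0`; the optimal datum; Cremona's Manin computation `h300` (`N ≤ 300000`); the unit Kurihara number `δ̃_{220459} ≢ 0 (mod 7)` at the cyclic
pair level `n = 449·491 ∈ 𝒩₁(W,7)`, kit j261654) give L₀(W,7) by the record `PlusEtaR0Kurihara.etaR0_kur_v141512r1_7`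
(minimality, `Δ ≠ 0`, surjectivity of `ρ̄_{W,7}` and the level IN THE KERNEL there), whence the pair's (E⁺_η) and (C1⁺_η) by §1.
Statement shape = the registered rung `stub_etaLower_rung_39675m1_inputs` generalised to this row. CONDITIONAL; a per-row instance; nothing booked; `BSD(W,7)` not claimed.
[cite: Kobayashi2003, §4 Even main conjecture and Thm. 4.1 (p. 8)] [cite: Kim2022StructureSelmer, Thm. 1.9 (6) (PDF p. 8)] [cite: Cremona1997, Table 1 (label 141512r1)] -/
theorem etaPair_r0_v141512r1_7
    (hPT : poitouTate_selmerStructure_duality_real ℚ) (hmod : hasEntireLFunction_rat)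
    (hGZK : rank_eq_analyticRank_of_analyticRank_le_one)
    (h22 : Kobayashi2003.thm22_etaSignedSelmerDual_finite_torsion)
    (h41 : Kobayashi2003.thm41_plusEtaCharIdeal_dvd)
    (hKO : KitajimaOtsuki2018.mainThm13_etaSignedSelmerDual_noFiniteSubmodule)
    (hKim : Kim2026.rankZero_le_padicValNat_sha_of_kuriharaNumber_ne_zero)
    (h300 : cremona_abs_maninConstant_eq_one_of_level_le_300000)
    (W : WeierstrassCurve ℚ) (hW : W = ⟨0, 1, 0, -2128576, -2202603488⟩)
    (hr : W.analyticRank = 0) (D : ModularParametrizationData W 141512)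
    (hopt : ∀ z ∈ D.L.lattice, ∃ w ∈ periodLattice D.f, z = D.c * w)
    (hδ : ∃ ψ : (ℓ : ℕ) → (ZMod ℓ)ˣ →* Multiplicative (ZMod (7 ^ 1)),
      (∀ ℓ ∈ (449 * 491 : ℕ).primeFactors, Function.Surjective (ψ ℓ)) ∧ kuriharaNumber D.f (7 ^ 1) (449 * 491) ψ ≠ 0) :
    ∀ (V : WeierstrassCurve ℚ) [V.IsElliptic] [V.IsGloballyMinimal] [Fact (7 : ℕ).Prime],
      (∃ C : VariableChange ℚ, C • W.quadraticTwist (-7) = V) →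
      V.HasGoodReductionAtPrime 7 → V.frobeniusTrace 7 = 0 →
      (∀ m : ℕ, V.HasSurjectiveModNGaloisRep (7 ^ m : ℕ)) →
        QuadraticBranchPlusEtaLowerInclusionAt V 7 ∧ QuadraticBranchPlusEtaMainConjectureAt V 7 := by
  have hlow : MissingLowerBoundAt W 7 :=
    PlusEtaR0Kurihara.etaR0_kur_v141512r1_7 hKim hGZK hmod h300 W hW hr D hopt hδ
  subst hW
  haveI := PlusEtaR0Kurihara.isElliptic_v141512r1
  haveI := PlusEtaR0Kurihara.isGloballyMinimal_v141512r1
  intro V _ _ _ hC hgood hap hsurj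
  obtain ⟨C, hCV⟩ := hC
  have hD : ((-1 : ℚ) ^ ((7 : ℕ) / 2) * ((7 : ℕ) : ℚ)) = (-7) := by norm_num
  exact etaPair_of_rankZero_of_missingLowerBoundAt hPT hmod hGZK h22 h41 hKO _ 7 (by norm_num) hr hlow V C
    (by rw [hD]; exact hCV) hgood hap hsurj

end Summit.BirchSwinnertonDyer.BirchSwinnertonDyer.Theorems.PlusEtaR0Rows

end
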